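import Summits.AtomisticToContinuum.FouriersLaw.Theorems.HonestZwanzigRobinCoercivityFluxReduction

/-!
# `HonestZwanzig.RobinCoercivity` — line LinAlg (card gradient-gram-schur-test): crux skeleton, rev 4

Crux `stmt-AtomisticToContinuum-12695`, decl `Summit.AtomisticToContinuum.FouriersLaw.Theses.HonestZwanzig.RobinCoercivity`.
LANDED (sorry-free, in the tree):
* `stub_feshbachIdentities` (p99025; also closes route item FeshbachIdentities, stmt-12697), `stub_feshbachMatrix` (p96750),
  `stub_gramDuality` (p96720), `stub_robinIncidence` (p97096) — `HonestZwanzigRobinCoercivityStub*.lean`;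
* `robin_fixedN` + `robinCoercivity_of_fluxBound` (p101879) — `HonestZwanzigRobinCoercivityFluxReduction.lean`: the crux follows
  from the N-uniform flux bound with `c = K⁻¹`;
* `flux_fixedN` + `fluxBound_of_robinCoercivity` (p105573) — `…FluxEquivalence.lean`: conversely the crux implies the flux bound
  (so crux ⟺ `stub_fluxBound`); `stub_gramDualityConverse` (p103564);
* `stub_fluxBoundPointwise` (p103966), `robinCoercivity_eachN`, `robinCoercivity_pointwise` (p105615) — `…Pointwise.lean`: the crux
  holds POINTWISE in `N` (`∀ N ∃ c(N)`, every `s > 0`) — only N-uniformity is open;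
* `robinCoercivity_of_rowSummableGram` (p106136) — `…RowSum.lean`: crux ⟸ N-uniform row-summability of `Γ_N(s) = Bχ⁻¹G_N(s)χ⁻¹Bᵀ`.
OPEN: `stub_fluxBound` — THE N-UNIFORM INPUT (equivalent to the crux given the fixed-`N` package): there is `K` such that for
all `N ≥ 2` and small `s`, `aᵀG_N(s)a ≤ K (Σ_{b+1<N} ψ_b² + φ₀² + φ₁²)` whenever the static charge `Cov(e,e)a` is the divergence
of the bond flux `ψ` and the contact fluxes `φ₀, φ₁` (uniform `H₋₁`/Thomson bound for energy-profile fluctuations).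
-/

noncomputable section

open MeasureTheory Finset Matrix
open Literature.MathematicalPhysics.KineticTheory.HeatConduction
open Summit.AtomisticToContinuum.FouriersLaw.Theses.HonestZwanzig

namespace Summit.AtomisticToContinuum.FouriersLaw.Theorems.HonestZwanzig.Robin

/-! ### The one open stub — the N-uniform flux bound (⟺ the crux) -/

/-- STUB (registered) — THE CRUX-EQUIVALENT N-UNIFORM INPUT. For `pinnedChain ω₂ lam β γ` (all `> 0`) and `T > 0` there is
`K > 0` such that for every `N ≥ 2` there is `s₀ > 0` with: for `0 < s < s₀`, every coefficient vector `a`, every bond flux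
`ψ` and contact fluxes `φ₀, φ₁` satisfying the charge/divergence relation
`Σ_y Cov(e_x,e_y) a_y = Σ_{b+1<N}([x=b+1] − [x=b])ψ_b + [x=0]φ₀ + [x=N−1]φ₁` for all `x`, the Laplace-transformed
autocorrelation obeys `Σ_{x,y} a_x lap_s(e_x,e_y) a_y ≤ K (Σ_{b+1<N}ψ_b² + φ₀² + φ₁²)` (gadgets `lap, cov, e` abstract with
their defining equations, so that the registered signature is `let`-free). -/
theorem stub_fluxBound : ∀ ω₂ lam β γ : ℝ, 0 < ω₂ → 0 < lam → 0 < β → 0 < γ → ∀ T : ℝ, 0 < T →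
    ∃ K : ℝ, 0 < K ∧ ∀ N : ℕ, 2 ≤ N → ∃ s₀ : ℝ, 0 < s₀ ∧
    ∀ (lap : ℝ → (PhaseSpace N → ℝ) → (PhaseSpace N → ℝ) → ℝ)
      (cov : (PhaseSpace N → ℝ) → (PhaseSpace N → ℝ) → ℝ) (e : Fin N → PhaseSpace N → ℝ),
    (∀ s f g, lap s f g = ∫ t in Set.Ioi (0 : ℝ), Real.exp (-(s * t)) *
      ((∫ z, f z * (∫ y, g y ∂((pinnedChain ω₂ lam β γ).transitionKernel N T T t.toNNReal z))
          ∂(pinnedChain ω₂ lam β γ).gibbsMeasure N T) -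
        (∫ z, f z ∂(pinnedChain ω₂ lam β γ).gibbsMeasure N T) *
          (∫ z, g z ∂(pinnedChain ω₂ lam β γ).gibbsMeasure N T))) →
    (∀ f g, cov f g = (∫ z, f z * g z ∂(pinnedChain ω₂ lam β γ).gibbsMeasure N T) -
      (∫ z, f z ∂(pinnedChain ω₂ lam β γ).gibbsMeasure N T) *
        (∫ z, g z ∂(pinnedChain ω₂ lam β γ).gibbsMeasure N T)) →
    (∀ x z, e x z = z.2 x ^ 2 / 2 + (pinnedChain ω₂ lam β γ).U (z.1 x) +
      ∑ j : Fin N, ((if j.val = x.val + 1 then (pinnedChain ω₂ lam β γ).V (z.1 j - z.1 x) / 2 else 0) +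
        (if x.val = j.val + 1 then (pinnedChain ω₂ lam β γ).V (z.1 x - z.1 j) / 2 else 0))) →
    ∀ s : ℝ, 0 < s → s < s₀ → ∀ (a ψ : Fin N → ℝ) (φ₀ φ₁ : ℝ),
      (∀ x : Fin N, ∑ y : Fin N, cov (e x) (e y) * a y =
        (∑ b : Fin N, if b.val + 1 < N then
          ((if x.val = b.val + 1 then ψ b else 0) - (if x = b then ψ b else 0)) else 0) +
        (if x.val = 0 then φ₀ else 0) + (if x.val = N - 1 then φ₁ else 0)) →
      ∑ x : Fin N, ∑ y : Fin N, a x * lap s (e x) (e y) * a y ≤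
        K * ((∑ b : Fin N, if b.val + 1 < N then ψ b ^ 2 else 0) + φ₀ ^ 2 + φ₁ ^ 2) := by
  sorry

/-! ### The crux -/

/-- **`RobinCoercivity`** (crux stmt-AtomisticToContinuum-12695 of route `HonestZwanzig`) from the one open stub, through the
landed transfer theorem `robinCoercivity_of_fluxBound`. -/
theorem RobinCoercivity_of : RobinCoercivity :=
  robinCoercivity_of_fluxBound stub_fluxBound

end Summit.AtomisticToContinuum.FouriersLaw.Theorems.HonestZwanzig.Robin

end
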